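import Summits.BirchSwinnertonDyer.Rank1Residual.GaloisImage.KolyvaginDerivativeUnramifiedClass
import Summits.BirchSwinnertonDyer.Rank1Residual.GaloisImage.KolyvaginDerivativeDescent
import HarnessLib

/-!
# Kolyvagin's descended class at a bad place is computed INSIDE the inertia invariants `T^{I}`
# when the Euler-system classes are unramified there — file U2 of the proposed row T-DER-BU
# ([MR04] Remark A.5's mechanism: `loc_w κ_r ∈ H¹_{(𝓕_u)}`, the structure PROPAGATED from
# `H¹_ur(ℚ_w, T)`, with NO condition on the Kolyvagin primes)
# (cell `b2b-bsdres`, team n1011, seat p15 GEN 27 — custodian by-product, OFFERED, not a deal)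

HONEST FRAMING (cell `b2b-bsdres`, run/shared/lean/b2b/bsd-rank1-residual/, verbatim in every
file): the goal of the cell is to DELETE the COMBINATION-SHAPED residual classes of the
Birch–Swinnerton-Dyer formula for ALL analytic-rank `≤ 1` elliptic curves over `ℚ` — "full BSD
formula for every rank `≤ 1` curve in class `C`" assembled STRICTLY from published theorems — so
that the rank-`≤ 1` remainder becomes exactly the CONSTRUCTION-SHAPED classes, which are TYPED
(missing-input `Prop`s), NOT attempted. This is not "finishing BSD". Team n1011 (N10 / N11, the
additive block X4 ∧ `p = 3`): research route on the CONSTRUCTION-SHAPED class X4; no claim beyond the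
stated classes; nothing is booked. TOOL theorems of continuous group cohomology (no definition, no
named fact, no `sorry`); curve-free, `p`-free, Euler-system-free.

## What

Abstract setting: a topological group `G` (`Γ_ℚ`), an open normal subgroup `N` (`Gal(ℚ̄/ℚ(μ_r))`),
subgroups `D` (a decomposition group at a place `w ∤ p·r`) and `I ≤ N` normalised by `D` (its
inertia group; `I ≤ N` because `w` is unramified in `ℚ(μ_r)`), an equivariant coefficient map
`π : X ⟶ X′` (`T → T/M`) with `(X′)^N = 0` (`h0`, THEOREM A3's descent hypothesis), a class
`Y ∈ H¹(N, X)` (`D_r c_r`) and `κ ∈ H¹(G, X′)` with `res_N κ = π_* Y` (Kolyvagin's `κ_r`).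
HYPOTHESES at `w`: (a) `res_I Y = 0` (`hY`: `D_r c_r` is unramified at `w` — F7′
`forall_resLe_noncommProd_deriv_eq_zero` from the unramifiedness of `c_r`, Kato's (8.1.3) /
`ZetaBody` (C2)); (b) for every `g ∈ D` the class `g·Y − Y` is represented by a cocycle VANISHING on
`I` and KILLED POINTWISE by `π` (`hwit` — supplied by file U1: `(g − 1) D_r c_r ∈ 𝔞_r • (unramified
classes)`, `𝔞_r` killing `X′`).
CONCLUSION (`exists_rep_sub_coboundary_eq_red_invariant`): **`κ` has a representative `k` and there
is `v ∈ X′` such that for every `g ∈ D`, `k(g) − (g v − v) = π(t_g)` with `t_g ∈ X^{I}`** — the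
restriction of `κ` to `D` is, up to ONE coboundary, a function with values in `π(X^I)`; in
particular it is unramified and, at a place whose decomposition group is generated by `I` and a
Frobenius, it lies in the image of `H¹(D/I, X^I)`, i.e. in `im(H¹_ur(ℚ_w, T) → H¹(ℚ_w, T/M)) ⊆ 𝓕_can,w`
(the lift is file U4; this file is the descent computation only).  Proof: write `k|_N = π∘Z + ∂x′`,
`Z|_I = ∂s`, `g·Z − Z − ρ_g = ∂t_g` on `N`; the cocycle identity `g·k(g⁻¹ng) − k(n) = (n−1)k(g)` and
`(X′)^N = 0` give `k(g) = π t_g + (g x′ − x′)` EXACTLY (global rigidity); evaluating the witness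
identity on `u ∈ I` (where `ρ_g(u) = 0`, `Z(u) = (u−1)s`, `Z(g⁻¹ug) = (g⁻¹ug − 1)s`) gives
`t_g − (g s − s) ∈ X^I`; take `v = π s + x′`.

WHY (design `HOME/b2b-bsdres-n1011-p15/g27/T-DER-BU-SCOPING.md`): n1011's THEOREM D at an
anomalous bad place currently needs `p ∤ ord(w mod q)` for every Kolyvagin prime `q` (T-DER-BN E1 /
T-DER-D4BN: `cor ∘ res`), which EXCLUDES the 416 END-b-DEAD rows of planner r1's census (ROUTE-1
§61.3).  [MR04] Thm. 3.2.4 carries NO hypothesis at the bad primes and Remark A.5 (p. 81) records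
that the derivative classes lie in `H¹_{(𝓕_u)_n}`; this file is that remark's cocycle computation.

References: B. Mazur, K. Rubin, *Kolyvagin systems*, Mem. AMS 799 (2004), Thm. 3.2.4, App. A
Prop. A.2 and Remark A.5 (pp. 79–81 of the authors' file); K. Rubin, *Euler Systems* (2000),
Thm. 4.5.1, §4.6; K. Büyükboduk, *Tamagawa defect of Euler systems*, J. Number Theory 129 (2009)
402–417, §3 Remark 2 and Thm. 3.1; J.-P. Serre, *Galois Cohomology*, I §2.6 (b), I §5.1.
-/

noncomputable section

open CategoryTheory Function
open Literature.NumberTheory.GaloisRepresentations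
open Literature.NumberTheory.EllipticCurves (subgroupInclusion subgroupConj subgroupConj_apply_coe)

universe u v

namespace Summit.BirchSwinnertonDyer.Rank1Residual.GaloisImage

namespace Derivative

section Descent

variable {R : Type v} [CommRing R] [TopologicalSpace R]
variable {G : Type u} [Group G] [TopologicalSpace G] [IsTopologicalGroup G]
variable {X X' : TopRep.{u} R G}

omit [IsTopologicalGroup G] in
/-- The conjugation identity of a crossed homomorphism on the whole group:
`g · k(g⁻¹ n g) − k(n) = n · k(g) − k(g)` (expand `k(n g) = k(g · g⁻¹ n g)` both ways).
Serre, *Galois Cohomology*, I §5.1. [folklore] -/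
theorem smul_apply_conj_sub_apply_eq (k : contOneCocycles X') (g n : G) :
    X'.ρ g (k.1 (g⁻¹ * n * g)) - k.1 n = X'.ρ n (k.1 g) - k.1 g := by
  have h1 : k.1 (n * g) = k.1 n + X'.ρ n (k.1 g) := k.2 n g
  have h2 : k.1 (g * (g⁻¹ * n * g)) = k.1 g + X'.ρ g (k.1 (g⁻¹ * n * g)) := k.2 g _
  have e : g * (g⁻¹ * n * g) = n * g := by group
  rw [e, h1] at h2
  calc X'.ρ g (k.1 (g⁻¹ * n * g)) - k.1 n
      = (k.1 g + X'.ρ g (k.1 (g⁻¹ * n * g))) - k.1 g - k.1 n := by abel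
    _ = (k.1 n + X'.ρ n (k.1 g)) - k.1 g - k.1 n := by rw [h2]
    _ = X'.ρ n (k.1 g) - k.1 g := by abel

variable (π : X ⟶ X') (N : Subgroup G) [N.Normal]

/-- **Unramified descent of Kolyvagin's class at a bad place** ([MR04] Remark A.5, cocycle
computation; module docstring).  Data: `π : X ⟶ X′` equivariant, `N ⊴ G` with `(X′)^N = 0` (`h0`),
`D ≤ G`, `I ≤ N` normalised by `D` (`hI`), `κ ∈ H¹(G, X′)` and `Y ∈ H¹(N, X)` with `res_N κ = π_* Y`
(`hκ`).  Hypotheses: `res_I Y = 0` (`hY`) and, for every `g ∈ D`, a cocycle `ρ_g` on `N` representing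
`g·Y − Y`, vanishing on `I` and killed pointwise by `π` (`hwit`).  Conclusion: `κ = [k]` for a
cocycle `k` and some `v ∈ X′` with `k − ∂v` VANISHING on `I` and **`k(g) − (g·v − v) ∈ π(X^I)` for
every `g ∈ D`**.
[cite: MazurRubin2004, App. A Remark A.5 (p. 81)] [cite: Rubin2000, Thm. 4.5.1] -/
theorem exists_rep_sub_coboundary_eq_red_invariant (D I : Subgroup G) (hIN : I ≤ N)
    (hI : ∀ g ∈ D, ∀ u ∈ I, g⁻¹ * u * g ∈ I)
    (h0 : ∀ v : X', (∀ n : N, X'.ρ (n : G) v = v) → v = 0)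
    (κ : continuousCohomology 1 X') (Y : continuousCohomology 1 (subgroupRep X N))
    (hκ : resSubgroup X' N 1 κ = ContinuousCohomology.map (ContinuousMonoidHom.id N)
        (X := subgroupRep X N) (Y := subgroupRep X' N) ((TopRep.resFunctor N.subtype).map π) 1 Y)
    (hY : resLe X hIN 1 Y = 0)
    (hwit : ∀ g ∈ D, ∃ ρ : contOneCocycles (subgroupRep X N),
        conjMap X N g 1 Y - Y = oneCocycleClass _ ρ ∧
        (∀ u (hu : u ∈ I), ρ.1 ⟨u, hIN hu⟩ = 0) ∧ (∀ n : N, π.hom (ρ.1 n) = 0)) :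
    ∃ (k : contOneCocycles X') (v : X'), oneCocycleClass X' k = κ ∧
      (∀ u ∈ I, k.1 u - (X'.ρ u v - v) = 0) ∧
      ∀ g ∈ D, ∃ t : X, (∀ u ∈ I, X.ρ u t = t) ∧ k.1 g - (X'.ρ g v - v) = π.hom t := by
  obtain ⟨k, rfl⟩ := oneCocycleClass_surjective X' κ
  obtain ⟨Z, rfl⟩ := oneCocycleClass_surjective _ Y
  -- (1) `k|_N = π ∘ Z + ∂x'`
  rw [resSubgroup_oneCocycleClass, red_oneCocycleClass, ← sub_eq_zero, ← oneCocycleClass_sub,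
    oneCocycleClass_eq_zero_iff] at hκ
  obtain ⟨x', hx'⟩ := hκ
  have hkN : ∀ n : N, k.1 (n : G) = π.hom (Z.1 n) + (X'.ρ (n : G) x' - x') := by
    intro n
    have h := hx' n
    change k.1 (n : G) - π.hom (Z.1 n) = X'.ρ (n : G) x' - x' at h
    rwa [sub_eq_iff_eq_add'] at h
  -- (2) `Z|_I = ∂s`
  obtain ⟨s, hs⟩ := (resLe_oneCocycleClass_eq_zero_iff X N hIN Z).mp hY
  refine ⟨k, π.hom s + x', rfl, fun u hu => ?_, fun g hg => ?_⟩
  · -- on `I` the corrected cocycle vanishes: `k u = π(u s − s) + (u x' − x')`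
    have h := hkN ⟨u, hIN hu⟩
    rw [hs u hu] at h
    change k.1 u = π.hom (X.ρ u s - s) + (X'.ρ u x' - x') at h
    rw [h, map_sub, TopRep.hom_comm_apply, map_add]
    abel
  -- (3) the witness for `g`: `g·Z − Z − ρ = ∂t` on `N`
  obtain ⟨ρ, hρ, hρI, hρπ⟩ := hwit g hg
  rw [conjMap_oneCocycleClass, ← oneCocycleClass_sub, ← sub_eq_zero, ← oneCocycleClass_sub,
    oneCocycleClass_eq_zero_iff] at hρ
  obtain ⟨t, ht⟩ := hρ
  have ht' : ∀ n : N,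
      X.ρ g (Z.1 (subgroupConj N g n)) - Z.1 n - ρ.1 n = X.ρ (n : G) t - t := by
    intro n
    have h := ht n
    change X.ρ g (Z.1 (subgroupConj N g n)) - Z.1 n - ρ.1 n = X.ρ (n : G) t - t at h
    exact h
  have hZ : ∀ n : N, X.ρ g (Z.1 (subgroupConj N g n)) = Z.1 n + ρ.1 n + (X.ρ (n : G) t - t) := by
    intro n
    have h := ht' n
    rw [sub_sub, sub_eq_iff_eq_add] at h
    rw [h]
    abel
  -- (4) global rigidity: `k g = π t + (g x' − x')`
  have hkg : k.1 g = π.hom t + (X'.ρ g x' - x') := by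
    refine eq_of_forall_rho_sub_eq X' N h0 fun n => ?_
    have hc : ((subgroupConj N g n : N) : G) = g⁻¹ * n * g := subgroupConj_apply_coe N g n
    have e2 : k.1 (g⁻¹ * n * g) =
        π.hom (Z.1 (subgroupConj N g n)) + (X'.ρ (g⁻¹ * n * g) x' - x') := by
      rw [← hc]; exact hkN _
    have e5 : X'.ρ g (π.hom (Z.1 (subgroupConj N g n))) =
        π.hom (Z.1 n) + (X'.ρ (n : G) (π.hom t) - π.hom t) := by
      rw [← TopRep.hom_comm_apply, hZ n, map_add, map_add, hρπ n, add_zero, map_sub,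
        TopRep.hom_comm_apply]
    rw [← smul_apply_conj_sub_apply_eq k g n, e2, hkN n, map_add, map_sub, e5, ← ρ_mul_apply,
      show g * (g⁻¹ * (n : G) * g) = (n : G) * g by group, ρ_mul_apply, map_add, map_sub]
    abel
  -- (5) the corrected witness `t − (g s − s)` is fixed by `I`
  refine ⟨t - (X.ρ g s - s), fun u hu => ?_, ?_⟩
  · have hmem : g⁻¹ * u * g ∈ I := hI g hg u hu
    have h := ht' ⟨u, hIN hu⟩
    have hc : subgroupConj N g ⟨u, hIN hu⟩ = ⟨g⁻¹ * u * g, hIN hmem⟩ :=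
      Subtype.ext (subgroupConj_apply_coe N g _)
    rw [hc, hs _ hmem, hs u hu, hρI u hu, sub_zero, map_sub, ← ρ_mul_apply,
      show g * (g⁻¹ * u * g) = u * g by group, ρ_mul_apply] at h
    change X.ρ u (X.ρ g s) - X.ρ g s - (X.ρ u s - s) = X.ρ u t - t at h
    have h' : X.ρ u t = X.ρ u (X.ρ g s) - X.ρ g s - (X.ρ u s - s) + t := by
      rw [eq_comm, sub_eq_iff_eq_add] at h
      exact h
    rw [map_sub, map_sub, h']
    abel
  · -- (6) the value: `k g − (g v − v) = π (t − (g s − s))`, `v = π s + x'`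
    rw [hkg, map_sub, map_sub, TopRep.hom_comm_apply, map_add]
    abel

end Descent

end Derivative

end Summit.BirchSwinnertonDyer.Rank1Residual.GaloisImage

end
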